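import Literature.MathematicalPhysics.QuantumLattice.HubbardModelThermodynamicLimitProofs
import Literature.MathematicalPhysics.QuantumLattice.ProjectedBCSStateReal

/-!
# Rectangular fermionic tori `ℤ/aℤ × ℤ/bℤ`: relabelling invariance and the cut of the Hubbard
# ground-state energies (towards the two-dimensional thermodynamic limit)

Trunk T-QLATTICE (family `hubbard`); continuation of `HubbardModelThermodynamicLimitProofs.lean`
(the 1D ring) to two dimensions, written for the support item `TwPureThermalBound` of the route
`HubbardSuperconductivity/ThermalWedge` (canonical vs. grand-canonical ground-state energy of the
Hubbard torus `fermionTorusGraph 2 L`), whose proof needs the thermodynamic limit — and the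
convexity in the density — of the sector ground-state energies `E_{L×L}(N)/L²`
(Ruelle, *Statistical Mechanics* (1969), §2–§3: subadditivity by cutting boxes).

The subadditivity argument in `d = 2` cuts a torus in BOTH directions, which produces rectangular
tori `ℤ/aℤ × ℤ/bℤ` as intermediate objects and needs the freedom to re-order the sites (the cut
lemma `ThermodynamicLimit.groundEnergyAt_le_add_of_cut` splits the LINEARLY ORDERED site set into a
lower and an upper block, so only the major coordinate can be cut). This file provides:

* `fermionRectTorusGraph a b : SimpleGraph (Fin a ×ₗ Fin b)` — the nearest-neighbour graph of
  `ℤ/aℤ × ℤ/bℤ` on the lexicographically ordered vertex set (first coordinate major), the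
  rectangular analogue of `fermionTorusGraph` (the tree's `rectTorusGraph Ls` of `LatticeTori.lean`
  lives on the unordered `ZMod`-valued sites `RectTorusSite Ls`, exactly as `torusGraph` vs.
  `fermionTorusGraph`; ring adjacency is written on representatives, `ringAdj`, in the form of
  `ThermodynamicLimit.fermionTorusGraph_one_adj_iff`);
* `squareToRect L : FermionTorus 2 L ≃ Fin L ×ₗ Fin L` is a graph isomorphism
  `fermionTorusGraph 2 L ≅ fermionRectTorusGraph L L` (`fermionRectTorusGraph_adj_squareToRect`),
  and `rectSwap a b` one `ℤ/aℤ × ℤ/bℤ ≅ ℤ/bℤ × ℤ/aℤ`;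
* **relabelling invariance of the sector ground-state energies**: the signed permutation of the
  occupation bases underlying the tree's `relabel e` (`FermionRelabelling.lean`; on vectors the
  tree's `relabelVec e` of `ProjectedBCSStateReal.lean`, with its inverse `relabelVecInv e` added
  here) maps the `N`-particle unit sphere onto the relabelled one preserving expectations, so `groundEnergy (relabel e a) N = groundEnergy a N` (`groundEnergy_relabel`) and
  the Hubbard sector energies `groundEnergyAt` are invariant under ARBITRARY graph isomorphisms
  (`groundEnergyAt_eq_of_iso`; with `relabel_hamiltonian`), in particular
  `E_{torus L} = E_{L×L}` and `E_{a×b} = E_{b×a}`;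
* **the major cut** `groundEnergyAt_rect_cut`:
  `E_{(a₁+a₂)×b}(N₁ + N₂) ≤ E_{a₁×b}(N₁) + E_{a₂×b}(N₂) + 8|t| b` (`N_i ≤ 2a_ib`), an instance of
  `groundEnergyAt_le_add_of_cut` (block embeddings `rectCastAdd`, `rectNatAdd`; the adjacency
  patterns differ only on the `2b + 2b` ordered wrap-around pairs, `cut_low_wrap`/`cut_high_wrap`).

Everything is proved; the only definitions are the graph, the site bijections/embeddings and the
inverse `relabelVecInv` of the existing signed permutation `relabelVec`. [folklore]

## Sources

D. Ruelle, *Statistical Mechanics: Rigorous Results* (Benjamin, 1969), §2.2–§3.3 (thermodynamic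
limit of lattice systems by subadditivity over boxes); O. Bratteli, D. W. Robinson, *Operator
Algebras and Quantum Statistical Mechanics II*, §5.2.2 (unitary implementation of one-particle
bijections in the Fock = Jordan–Wigner representation).
-/

noncomputable section

open Matrix Finset
open scoped ComplexOrder BigOperators

namespace Literature.MathematicalPhysics.QuantumLattice

/-- Nearest-neighbour adjacency on the ring `ℤ/nℤ` in terms of representatives `u, v < n`:
`u ∼ v ↔ u ≠ v ∧ (v ≡ u + 1 ∨ u ≡ v + 1 (mod n))` (the form of
`ThermodynamicLimit.fermionTorusGraph_one_adj_iff`). [folklore] -/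
def ringAdj (n u v : ℕ) : Prop := u ≠ v ∧ ((u + 1) % n = v ∨ (v + 1) % n = u)

/-- Ring adjacency of representatives is decidable. [folklore] -/
instance instDecidableRingAdj (n u v : ℕ) : Decidable (ringAdj n u v) := inferInstanceAs (Decidable (_ ∧ _))

/-- Ring adjacency is symmetric. [folklore] -/
theorem ringAdj_symm {n u v : ℕ} (h : ringAdj n u v) : ringAdj n v u :=
  ⟨h.1.symm, h.2.symm⟩

/-- Ring adjacency is irreflexive. [folklore] -/
theorem ringAdj_irrefl (n u : ℕ) : ¬ ringAdj n u u := fun h => h.1 rfl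

/-- The **rectangular fermionic torus** `ℤ/aℤ × ℤ/bℤ`: vertex set `Fin a ×ₗ Fin b` with the
lexicographic LINEAR order (first coordinate major, as the Jordan–Wigner construction needs), and
`(x, y) ∼ (x', y')` iff the sites agree in one coordinate and are ring-neighbours in the other.
For `a = b = L` this is (isomorphic to) `fermionTorusGraph 2 L`. [folklore] -/
def fermionRectTorusGraph (a b : ℕ) : SimpleGraph (Fin a ×ₗ Fin b) where
  Adj p q := ((ofLex p).2 = (ofLex q).2 ∧ ringAdj a (ofLex p).1 (ofLex q).1) ∨
    ((ofLex p).1 = (ofLex q).1 ∧ ringAdj b (ofLex p).2 (ofLex q).2)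
  symm := ⟨fun p q h => by
    rcases h with ⟨h1, h2⟩ | ⟨h1, h2⟩
    · exact Or.inl ⟨h1.symm, ringAdj_symm h2⟩
    · exact Or.inr ⟨h1.symm, ringAdj_symm h2⟩⟩
  loopless := ⟨fun p h => by
    rcases h with ⟨-, h2⟩ | ⟨-, h2⟩
    · exact ringAdj_irrefl _ _ h2
    · exact ringAdj_irrefl _ _ h2⟩

/-- Adjacency on the rectangular fermionic torus is decidable. [folklore] -/
instance instDecidableRelFermionRectTorusGraphAdj (a b : ℕ) :
    DecidableRel (fermionRectTorusGraph a b).Adj := fun p q =>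
  inferInstanceAs (Decidable (((ofLex p).2 = (ofLex q).2 ∧ ringAdj a (ofLex p).1 (ofLex q).1) ∨
    ((ofLex p).1 = (ofLex q).1 ∧ ringAdj b (ofLex p).2 (ofLex q).2)))

/-- Adjacency on the rectangular fermionic torus, unfolded. [folklore] -/
theorem fermionRectTorusGraph_adj_iff {a b : ℕ} (p q : Fin a ×ₗ Fin b) :
    (fermionRectTorusGraph a b).Adj p q ↔
      ((ofLex p).2 = (ofLex q).2 ∧ ringAdj a (ofLex p).1 (ofLex q).1) ∨
        ((ofLex p).1 = (ofLex q).1 ∧ ringAdj b (ofLex p).2 (ofLex q).2) := Iff.rfl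

/-! ### The square torus `fermionTorusGraph 2 L` is the rectangular torus `L × L` -/

/-- The site bijection `x ↦ (x 0, x 1)` from `FermionTorus 2 L = Lex (Fin 2 → Fin L)` to
`Fin L ×ₗ Fin L`. [folklore] -/
def squareToRect (L : ℕ) : FermionTorus 2 L ≃ Fin L ×ₗ Fin L where
  toFun x := toLex (ofLex x 0, ofLex x 1)
  invFun p := toLex ![(ofLex p).1, (ofLex p).2]
  left_inv x := by
    refine ofLex.injective (funext fun i => ?_)
    fin_cases i <;> rfl
  right_inv p := by
    refine ofLex.injective (Prod.ext ?_ ?_) <;> rfl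

/-- First coordinate of `squareToRect`. [folklore] -/
@[simp] theorem ofLex_squareToRect_fst (L : ℕ) (x : FermionTorus 2 L) :
    (ofLex (squareToRect L x)).1 = ofLex x 0 := rfl

/-- Second coordinate of `squareToRect`. [folklore] -/
@[simp] theorem ofLex_squareToRect_snd (L : ℕ) (x : FermionTorus 2 L) :
    (ofLex (squareToRect L x)).2 = ofLex x 1 := rfl

/-- `ZMod` arithmetic of representatives: for `u, v < L`, `(v : ZMod L) = u + 1 ↔ (u + 1) % L = v`.
[folklore] -/
theorem zmod_natCast_eq_add_one_iff {L : ℕ} (u v : Fin L) :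
    ((v : ℕ) : ZMod L) = ((u : ℕ) : ZMod L) + 1 ↔ ((u : ℕ) + 1) % L = v := by
  rw [← Nat.cast_succ, ZMod.natCast_eq_natCast_iff', Nat.mod_eq_of_lt v.isLt, eq_comm]

/-- **The square torus is a rectangular torus**: `squareToRect` carries the adjacency of
`fermionTorusGraph 2 L` onto that of `fermionRectTorusGraph L L`. [folklore] -/
theorem fermionRectTorusGraph_adj_squareToRect {L : ℕ} (x y : FermionTorus 2 L) :
    (fermionRectTorusGraph L L).Adj (squareToRect L x) (squareToRect L y) ↔
      (fermionTorusGraph 2 L).Adj x y := by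
  rw [fermionTorusGraph_adj, Literature.Probability.LatticeModels.torusGraph_adj_iff,
    fermionRectTorusGraph_adj_iff, ofLex_squareToRect_fst, ofLex_squareToRect_snd,
    ofLex_squareToRect_fst, ofLex_squareToRect_snd]
  -- coordinates as `ZMod L`
  have hc : ∀ (u : FermionTorus 2 L) (i : Fin 2),
      FermionTorus.toTorusSite u i = ((ofLex u i : ℕ) : ZMod L) := fun u i => rfl
  have hinj : ∀ (u v : Fin L), ((u : ℕ) : ZMod L) = ((v : ℕ) : ZMod L) ↔ u = v := by
    intro u v
    rw [ZMod.natCast_eq_natCast_iff', Nat.mod_eq_of_lt u.isLt, Nat.mod_eq_of_lt v.isLt]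
    exact Fin.val_inj
  -- `v = u + e_i` in coordinates
  have hstep : ∀ (u v : FermionTorus 2 L) (i : Fin 2),
      FermionTorus.toTorusSite v = FermionTorus.toTorusSite u + Pi.single i 1 ↔
        ((ofLex u i : ℕ) + 1) % L = ofLex v i ∧ ofLex u (1 - i) = ofLex v (1 - i) := by
    intro u v i
    rw [funext_iff, Fin.forall_fin_two, Pi.add_apply, Pi.add_apply, hc, hc, hc, hc]
    fin_cases i
    · simp only [Pi.single_eq_same, Fin.zero_eta, ne_eq, one_ne_zero, not_false_eq_true,
        Pi.single_eq_of_ne, add_zero, sub_zero, Fin.isValue]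
      rw [zmod_natCast_eq_add_one_iff, hinj]
      exact Iff.and Iff.rfl eq_comm
    · simp only [Fin.mk_one, Fin.isValue, ne_eq, zero_ne_one, not_false_eq_true,
        Pi.single_eq_of_ne, add_zero, Pi.single_eq_same, sub_self]
      rw [zmod_natCast_eq_add_one_iff, hinj]
      exact and_comm.trans (Iff.and Iff.rfl eq_comm)
  have hext : ∀ u v : FermionTorus 2 L, u = v ↔ ofLex u 0 = ofLex v 0 ∧ ofLex u 1 = ofLex v 1 := by
    intro u v
    constructor
    · rintro rfl; exact ⟨rfl, rfl⟩
    · rintro ⟨h0, h1⟩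
      exact ofLex.injective (funext fun i => by fin_cases i <;> assumption)
  have hne : FermionTorus.toTorusSite x ≠ FermionTorus.toTorusSite y ↔ x ≠ y := by
    refine not_congr ⟨fun h => ?_, fun h => h ▸ rfl⟩
    rw [funext_iff, Fin.forall_fin_two, hc, hc, hc, hc, hinj, hinj] at h
    exact (hext x y).2 h
  rw [hne, Fin.exists_fin_two, Fin.exists_fin_two, hstep, hstep, hstep, hstep]
  simp only [Fin.isValue, sub_zero, sub_self, ringAdj]
  have hv0 : ∀ {u v : Fin L}, (u : ℕ) ≠ v ↔ u ≠ v := fun {u v} => Fin.val_ne_iff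
  constructor
  · rintro (⟨h1, hne0, hq | hr⟩ | ⟨h0, hne1, hq | hr⟩)
    · exact ⟨fun h => hv0.1 hne0 (congrArg (fun u : FermionTorus 2 L => ofLex u 0) h), Or.inl (Or.inl ⟨hq, h1⟩)⟩
    · exact ⟨fun h => hv0.1 hne0 (congrArg (fun u : FermionTorus 2 L => ofLex u 0) h), Or.inr (Or.inl ⟨hr, h1.symm⟩)⟩
    · exact ⟨fun h => hv0.1 hne1 (congrArg (fun u : FermionTorus 2 L => ofLex u 1) h), Or.inl (Or.inr ⟨hq, h0⟩)⟩
    · exact ⟨fun h => hv0.1 hne1 (congrArg (fun u : FermionTorus 2 L => ofLex u 1) h), Or.inr (Or.inr ⟨hr, h0.symm⟩)⟩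
  · rintro ⟨hxy, (⟨hq, h1⟩ | ⟨hq, h0⟩) | (⟨hr, h1⟩ | ⟨hr, h0⟩)⟩
    · refine Or.inl ⟨h1, hv0.2 fun h => hxy ((hext x y).2 ⟨h, h1⟩), Or.inl hq⟩
    · refine Or.inr ⟨h0, hv0.2 fun h => hxy ((hext x y).2 ⟨h0, h⟩), Or.inl hq⟩
    · refine Or.inl ⟨h1.symm, hv0.2 fun h => hxy ((hext x y).2 ⟨h, h1.symm⟩), Or.inr hr⟩
    · refine Or.inr ⟨h0.symm, hv0.2 fun h => hxy ((hext x y).2 ⟨h0.symm, h⟩), Or.inr hr⟩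

/-! ### Sector ground energies are invariant under relabelling of the orbitals -/

section RelabelVec

variable {ι ι' : Type*} [LinearOrder ι] [LinearOrder ι'] [Fintype ι] [Fintype ι'] (e : ι ≃ ι')

/-- The inverse signed permutation `(Γ⁻¹ ψ')(s) = ε_e(s) ψ'(e s)`. [folklore] -/
def relabelVecInv (ψ' : Fock ι') : Fock ι := fun s => relabelSign e s * ψ' (e.finsetCongr s)

omit [Fintype ι] [Fintype ι'] in
/-- `Γ Γ⁻¹ = 1` on vectors. [folklore] -/
theorem relabelVec_relabelVecInv (ψ' : Fock ι') : relabelVec e (relabelVecInv e ψ') = ψ' := by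
  funext s'
  obtain ⟨s, rfl⟩ := e.finsetCongr.surjective s'
  rw [relabelVec_apply_finsetCongr, relabelVecInv, ← mul_assoc, relabelSign_mul_self, one_mul]

omit [Fintype ι] [Fintype ι'] in
/-- `Γ` preserves the particle-number sectors. [folklore] -/
theorem isNParticle_relabelVec {N : ℕ} {ψ : Fock ι} (hψ : IsNParticle N ψ) :
    IsNParticle N (relabelVec e ψ) := by
  intro s' hs'
  obtain ⟨s, rfl⟩ := e.finsetCongr.surjective s'
  rw [relabelVec_apply_finsetCongr, hψ s ?_, mul_zero]
  rwa [Equiv.finsetCongr_apply, Finset.card_map] at hs'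

omit [Fintype ι] [Fintype ι'] in
/-- `Γ⁻¹` preserves the particle-number sectors. [folklore] -/
theorem isNParticle_relabelVecInv {N : ℕ} {ψ' : Fock ι'} (hψ : IsNParticle N ψ') :
    IsNParticle N (relabelVecInv e ψ') := by
  intro s hs
  rw [relabelVecInv, hψ _ ?_, mul_zero]
  rwa [Equiv.finsetCongr_apply, Finset.card_map]

/-- Expectations are invariant: `⟨Γψ, (Γ a Γ⁻¹) Γψ⟩ = ⟨ψ, a ψ⟩`. [folklore] -/
theorem expect_relabel_relabelVec (a : Matrix (Finset ι) (Finset ι) ℂ) (ψ : Fock ι) :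
    expect (relabel e a) (relabelVec e ψ) = expect a ψ := by
  unfold expect
  rw [relabel_mulVec_relabelVec, star_relabelVec_dotProduct]

/-- **Sector ground energies are invariant under relabelling**:
`E_N(Γ a Γ⁻¹) = E_N(a)` for every orbital bijection `e : ι ≃ ι'` (the signed permutation maps
the unit sphere of the `N`-particle sector onto that of the relabelled sector, preserving
expectations). [folklore] -/
theorem groundEnergy_relabel (a : Matrix (Finset ι) (Finset ι) ℂ) (N : ℕ) :
    groundEnergy (relabel e a) N = groundEnergy a N := by
  unfold groundEnergy
  congr 1
  ext E
  constructor
  · rintro ⟨ψ', hN, h1, rfl⟩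
    refine ⟨relabelVecInv e ψ', isNParticle_relabelVecInv e hN, ?_, ?_⟩
    · rw [← star_relabelVec_dotProduct e, relabelVec_relabelVecInv, h1]
    · rw [← expect_relabel_relabelVec e, relabelVec_relabelVecInv]
  · rintro ⟨ψ, hN, h1, rfl⟩
    exact ⟨relabelVec e ψ, isNParticle_relabelVec e hN,
      by rw [star_relabelVec_dotProduct, h1], by rw [expect_relabel_relabelVec]⟩

end RelabelVec

/-- **Sector ground energies of the Hubbard model are invariant under graph isomorphisms**
(arbitrary re-ordering of the sites included). [folklore] -/
theorem groundEnergyAt_eq_of_iso {Λ Λ' : Type*} [LinearOrder Λ] [LinearOrder Λ'] [Fintype Λ]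
    [Fintype Λ'] (G : SimpleGraph Λ) [DecidableRel G.Adj] (G' : SimpleGraph Λ')
    [DecidableRel G'.Adj] (f : Λ ≃ Λ') (hG : ∀ x y, G'.Adj (f x) (f y) ↔ G.Adj x y) (t U : ℝ)
    (N : ℕ) : groundEnergyAt G' t U N = groundEnergyAt G t U N := by
  rw [groundEnergyAt, groundEnergyAt, ← relabel_hamiltonian G G' f hG t U, groundEnergy_relabel]

/-! ### Isomorphisms of rectangular tori -/

/-- The coordinate swap `(x, y) ↦ (y, x)`. [folklore] -/
def rectSwap (a b : ℕ) : Fin a ×ₗ Fin b ≃ Fin b ×ₗ Fin a where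
  toFun p := toLex ((ofLex p).2, (ofLex p).1)
  invFun q := toLex ((ofLex q).2, (ofLex q).1)
  left_inv _ := rfl
  right_inv _ := rfl

/-- The coordinate swap is a graph isomorphism `ℤ/aℤ × ℤ/bℤ ≅ ℤ/bℤ × ℤ/aℤ`. [folklore] -/
theorem fermionRectTorusGraph_adj_rectSwap {a b : ℕ} (p q : Fin a ×ₗ Fin b) :
    (fermionRectTorusGraph b a).Adj (rectSwap a b p) (rectSwap a b q) ↔
      (fermionRectTorusGraph a b).Adj p q := by
  rw [fermionRectTorusGraph_adj_iff, fermionRectTorusGraph_adj_iff]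
  exact Or.comm

/-- **Swap invariance**: `E_{a×b}(N) = E_{b×a}(N)`. [folklore] -/
theorem groundEnergyAt_rect_swap (a b : ℕ) (t U : ℝ) (N : ℕ) :
    groundEnergyAt (fermionRectTorusGraph b a) t U N =
      groundEnergyAt (fermionRectTorusGraph a b) t U N :=
  groundEnergyAt_eq_of_iso _ _ (rectSwap a b) fermionRectTorusGraph_adj_rectSwap t U N

/-- **The square torus as a rectangular torus**: `E_{torus L}(N) = E_{L×L}(N)`. [folklore] -/
theorem groundEnergyAt_fermionTorusGraph_two (L : ℕ) (t U : ℝ) (N : ℕ) :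
    groundEnergyAt (fermionTorusGraph 2 L) t U N =
      groundEnergyAt (fermionRectTorusGraph L L) t U N :=
  (groundEnergyAt_eq_of_iso _ _ (squareToRect L) fermionRectTorusGraph_adj_squareToRect t U N).symm

/-! ### Cutting a rectangular torus along the major coordinate -/

section Cut

open ThermodynamicLimit

variable {α α' β : Type*} [LinearOrder α] [LinearOrder α'] [LinearOrder β]

omit [LinearOrder β] in
/-- A strictly monotone map of the major coordinate is strictly monotone for the lexicographic
order. [folklore] -/
theorem strictMono_lex_map [PartialOrder β] {g : α → α'} (hg : StrictMono g) :
    StrictMono (fun p : α ×ₗ β => toLex (g (ofLex p).1, (ofLex p).2)) := by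
  intro p q h
  rw [Prod.Lex.lt_iff] at h ⊢
  simp only [ofLex_toLex]
  rcases h with h | ⟨h1, h2⟩
  · exact Or.inl (hg h)
  · exact Or.inr ⟨by rw [h1], h2⟩

end Cut

section RectCut

open ThermodynamicLimit

/-- The lower block `x ↦ x` of the cut of `ℤ/(a₁+a₂)ℤ × ℤ/bℤ` at `a₁`. [folklore] -/
def rectCastAdd (a₁ a₂ b : ℕ) (p : Fin a₁ ×ₗ Fin b) : Fin (a₁ + a₂) ×ₗ Fin b :=
  toLex (Fin.castAdd a₂ (ofLex p).1, (ofLex p).2)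

/-- The upper block `x ↦ a₁ + x` of the cut of `ℤ/(a₁+a₂)ℤ × ℤ/bℤ` at `a₁`. [folklore] -/
def rectNatAdd (a₁ a₂ b : ℕ) (p : Fin a₂ ×ₗ Fin b) : Fin (a₁ + a₂) ×ₗ Fin b :=
  toLex (Fin.natAdd a₁ (ofLex p).1, (ofLex p).2)

/-- The lower block embedding is strictly monotone. [folklore] -/
theorem strictMono_rectCastAdd (a₁ a₂ b : ℕ) : StrictMono (rectCastAdd a₁ a₂ b) :=
  strictMono_lex_map (Fin.strictMono_castAdd a₂)

/-- The upper block embedding is strictly monotone. [folklore] -/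
theorem strictMono_rectNatAdd (a₁ a₂ b : ℕ) : StrictMono (rectNatAdd a₁ a₂ b) :=
  strictMono_lex_map (Fin.strictMono_natAdd a₁)

/-- The lower block lies below the upper block. [folklore] -/
theorem rectCastAdd_lt_rectNatAdd (a₁ a₂ b : ℕ) (p : Fin a₁ ×ₗ Fin b) (q : Fin a₂ ×ₗ Fin b) :
    rectCastAdd a₁ a₂ b p < rectNatAdd a₁ a₂ b q := by
  rw [rectCastAdd, rectNatAdd, Prod.Lex.lt_iff]
  simp only [ofLex_toLex]
  refine Or.inl (Fin.lt_def.2 ?_)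
  simp only [Fin.val_castAdd, Fin.val_natAdd]
  have := (ofLex p).1.isLt
  omega

/-- The two blocks cover the big torus. [folklore] -/
theorem rectCastAdd_cover (a₁ a₂ b : ℕ) (z : Fin (a₁ + a₂) ×ₗ Fin b) :
    (∃ p, rectCastAdd a₁ a₂ b p = z) ∨ ∃ q, rectNatAdd a₁ a₂ b q = z := by
  obtain ⟨x | y, h⟩ := finSumFinEquiv.surjective (ofLex z).1
  · refine Or.inl ⟨toLex (x, (ofLex z).2), ?_⟩
    rw [rectCastAdd]
    simp only [ofLex_toLex]
    rw [finSumFinEquiv_apply_left] at h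
    rw [h]; rfl
  · refine Or.inr ⟨toLex (y, (ofLex z).2), ?_⟩
    rw [rectNatAdd]
    simp only [ofLex_toLex]
    rw [finSumFinEquiv_apply_right] at h
    rw [h]; rfl

/-- Adjacency of the big torus on the lower block. [folklore] -/
theorem adj_rectCastAdd_iff {a₁ a₂ b : ℕ} (p q : Fin a₁ ×ₗ Fin b) :
    (fermionRectTorusGraph (a₁ + a₂) b).Adj (rectCastAdd a₁ a₂ b p) (rectCastAdd a₁ a₂ b q) ↔
      ((ofLex p).2 = (ofLex q).2 ∧ ringAdj (a₁ + a₂) (ofLex p).1 (ofLex q).1) ∨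
        ((ofLex p).1 = (ofLex q).1 ∧ ringAdj b (ofLex p).2 (ofLex q).2) := by
  rw [fermionRectTorusGraph_adj_iff, rectCastAdd, rectCastAdd]
  simp only [ofLex_toLex, Fin.val_castAdd, (Fin.castAdd_injective _ _).eq_iff]

/-- Adjacency of the big torus on the upper block. [folklore] -/
theorem adj_rectNatAdd_iff {a₁ a₂ b : ℕ} (p q : Fin a₂ ×ₗ Fin b) :
    (fermionRectTorusGraph (a₁ + a₂) b).Adj (rectNatAdd a₁ a₂ b p) (rectNatAdd a₁ a₂ b q) ↔
      ((ofLex p).2 = (ofLex q).2 ∧ ringAdj (a₁ + a₂) (a₁ + (ofLex p).1) (a₁ + (ofLex q).1)) ∨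
        ((ofLex p).1 = (ofLex q).1 ∧ ringAdj b (ofLex p).2 (ofLex q).2) := by
  rw [fermionRectTorusGraph_adj_iff, rectNatAdd, rectNatAdd]
  simp only [ofLex_toLex, Fin.val_natAdd, (Fin.natAdd_injective _ _).eq_iff]

/-- The wrap-around pairs of the lower block number at most `2b`. [folklore] -/
theorem card_discrepancy_rectCastAdd (a₁ a₂ b : ℕ) :
    #{pq : (Fin a₁ ×ₗ Fin b) × (Fin a₁ ×ₗ Fin b) |
        ¬ ((fermionRectTorusGraph (a₁ + a₂) b).Adj (rectCastAdd a₁ a₂ b pq.1)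
            (rectCastAdd a₁ a₂ b pq.2) ↔ (fermionRectTorusGraph a₁ b).Adj pq.1 pq.2)} ≤ 2 * b := by
  calc _ ≤ #(({((0 : ℕ), a₁ - 1), (a₁ - 1, 0)} : Finset (ℕ × ℕ)) ×ˢ (Finset.univ : Finset (Fin b))) := by
        refine Finset.card_le_card_of_injOn
          (fun pq => ((((ofLex pq.1).1 : ℕ), ((ofLex pq.2).1 : ℕ)), (ofLex pq.1).2)) ?_ ?_
        · intro pq hpq
          rw [Finset.mem_coe, Finset.mem_filter, adj_rectCastAdd_iff,
            fermionRectTorusGraph_adj_iff] at hpq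
          obtain ⟨-, hpq⟩ := hpq
          rw [Finset.coe_product, Set.mem_prod, Finset.coe_insert, Finset.coe_singleton,
            Set.mem_insert_iff, Set.mem_singleton_iff, Finset.coe_univ]
          refine ⟨?_, Set.mem_univ _⟩
          by_cases h2 : (ofLex pq.1).2 = (ofLex pq.2).2
          · have hirr : ¬ ringAdj b ((ofLex pq.1).2 : ℕ) (ofLex pq.2).2 := by
              rw [h2]; exact ringAdj_irrefl _ _
            have h' : ¬ (ringAdj (a₁ + a₂) ((ofLex pq.1).1 : ℕ) (ofLex pq.2).1 ↔
                ringAdj a₁ ((ofLex pq.1).1 : ℕ) (ofLex pq.2).1) := by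
              intro hiff; apply hpq
              constructor
              · rintro (⟨-, h⟩ | ⟨-, h⟩)
                · exact Or.inl ⟨h2, hiff.1 h⟩
                · exact absurd h hirr
              · rintro (⟨-, h⟩ | ⟨-, h⟩)
                · exact Or.inl ⟨h2, hiff.2 h⟩
                · exact absurd h hirr
            have hw := cut_low_wrap (L₂ := a₂) (ofLex pq.1).1.isLt (ofLex pq.2).1.isLt h'
            rcases hw with ⟨h1, h3⟩ | ⟨h1, h3⟩
            · exact Or.inl (Prod.ext h1 h3)
            · exact Or.inr (Prod.ext h1 h3)
          · exfalso; apply hpq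
            constructor
            · rintro (⟨h, -⟩ | ⟨h, h'⟩)
              · exact absurd h h2
              · exact Or.inr ⟨h, h'⟩
            · rintro (⟨h, -⟩ | ⟨h, h'⟩)
              · exact absurd h h2
              · exact Or.inr ⟨h, h'⟩
        · intro pq hpq pq' hpq' h
          simp only [Prod.mk.injEq] at h
          obtain ⟨⟨h1, h2⟩, h3⟩ := h
          rw [Finset.mem_coe, Finset.mem_filter] at hpq hpq'
          -- on the discrepancy set the second coordinates of the pair agree
          have hsnd : ∀ {pq : (Fin a₁ ×ₗ Fin b) × (Fin a₁ ×ₗ Fin b)},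
              ¬ ((fermionRectTorusGraph (a₁ + a₂) b).Adj (rectCastAdd a₁ a₂ b pq.1)
                (rectCastAdd a₁ a₂ b pq.2) ↔ (fermionRectTorusGraph a₁ b).Adj pq.1 pq.2) →
              (ofLex pq.1).2 = (ofLex pq.2).2 := by
            intro pq hne
            by_contra h2
            apply hne
            rw [adj_rectCastAdd_iff, fermionRectTorusGraph_adj_iff]
            constructor
            · rintro (⟨h, -⟩ | ⟨h, h'⟩)
              · exact absurd h h2
              · exact Or.inr ⟨h, h'⟩
            · rintro (⟨h, -⟩ | ⟨h, h'⟩)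
              · exact absurd h h2
              · exact Or.inr ⟨h, h'⟩
          have e1 : pq.1 = pq'.1 :=
            ofLex.injective (Prod.ext (Fin.ext h1) h3)
          have e2 : pq.2 = pq'.2 :=
            ofLex.injective (Prod.ext (Fin.ext h2)
              (by rw [← hsnd hpq.2, ← hsnd hpq'.2, h3]))
          exact Prod.ext e1 e2
    _ ≤ 2 * b := by
        rw [Finset.card_product, Finset.card_univ, Fintype.card_fin]
        exact Nat.mul_le_mul_right _ Finset.card_le_two

/-- The wrap-around pairs of the upper block number at most `2b`. [folklore] -/
theorem card_discrepancy_rectNatAdd (a₁ a₂ b : ℕ) :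
    #{pq : (Fin a₂ ×ₗ Fin b) × (Fin a₂ ×ₗ Fin b) |
        ¬ ((fermionRectTorusGraph (a₁ + a₂) b).Adj (rectNatAdd a₁ a₂ b pq.1)
            (rectNatAdd a₁ a₂ b pq.2) ↔ (fermionRectTorusGraph a₂ b).Adj pq.1 pq.2)} ≤ 2 * b := by
  -- on the discrepancy set the second coordinates of the pair agree
  have hsnd : ∀ {pq : (Fin a₂ ×ₗ Fin b) × (Fin a₂ ×ₗ Fin b)},
      ¬ ((fermionRectTorusGraph (a₁ + a₂) b).Adj (rectNatAdd a₁ a₂ b pq.1)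
        (rectNatAdd a₁ a₂ b pq.2) ↔ (fermionRectTorusGraph a₂ b).Adj pq.1 pq.2) →
      (ofLex pq.1).2 = (ofLex pq.2).2 := by
    intro pq hne
    by_contra h2
    apply hne
    rw [adj_rectNatAdd_iff, fermionRectTorusGraph_adj_iff]
    constructor
    · rintro (⟨h, -⟩ | ⟨h, h'⟩)
      · exact absurd h h2
      · exact Or.inr ⟨h, h'⟩
    · rintro (⟨h, -⟩ | ⟨h, h'⟩)
      · exact absurd h h2
      · exact Or.inr ⟨h, h'⟩
  calc _ ≤ #(({((0 : ℕ), a₂ - 1), (a₂ - 1, 0)} : Finset (ℕ × ℕ)) ×ˢ (Finset.univ : Finset (Fin b))) := by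
        refine Finset.card_le_card_of_injOn
          (fun pq => ((((ofLex pq.1).1 : ℕ), ((ofLex pq.2).1 : ℕ)), (ofLex pq.1).2)) ?_ ?_
        · intro pq hpq
          rw [Finset.mem_coe, Finset.mem_filter] at hpq
          obtain ⟨-, hpq⟩ := hpq
          have h2 := hsnd hpq
          rw [adj_rectNatAdd_iff, fermionRectTorusGraph_adj_iff] at hpq
          rw [Finset.coe_product, Set.mem_prod, Finset.coe_insert, Finset.coe_singleton,
            Set.mem_insert_iff, Set.mem_singleton_iff, Finset.coe_univ]
          refine ⟨?_, Set.mem_univ _⟩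
          have hirr : ¬ ringAdj b ((ofLex pq.1).2 : ℕ) (ofLex pq.2).2 := by
            rw [h2]; exact ringAdj_irrefl _ _
          have h' : ¬ (ringAdj (a₁ + a₂) (a₁ + ((ofLex pq.1).1 : ℕ)) (a₁ + ((ofLex pq.2).1 : ℕ)) ↔
              ringAdj a₂ ((ofLex pq.1).1 : ℕ) (ofLex pq.2).1) := by
            intro hiff; apply hpq
            constructor
            · rintro (⟨-, h⟩ | ⟨-, h⟩)
              · exact Or.inl ⟨h2, hiff.1 h⟩
              · exact absurd h hirr
            · rintro (⟨-, h⟩ | ⟨-, h⟩)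
              · exact Or.inl ⟨h2, hiff.2 h⟩
              · exact absurd h hirr
          have hw := cut_high_wrap (L₁ := a₁) (ofLex pq.1).1.isLt (ofLex pq.2).1.isLt h'
          rcases hw with ⟨h1, h3⟩ | ⟨h1, h3⟩
          · exact Or.inl (Prod.ext h1 h3)
          · exact Or.inr (Prod.ext h1 h3)
        · intro pq hpq pq' hpq' h
          simp only [Prod.mk.injEq] at h
          obtain ⟨⟨h1, h2⟩, h3⟩ := h
          rw [Finset.mem_coe, Finset.mem_filter] at hpq hpq'
          have e1 : pq.1 = pq'.1 :=
            ofLex.injective (Prod.ext (Fin.ext h1) h3)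
          have e2 : pq.2 = pq'.2 :=
            ofLex.injective (Prod.ext (Fin.ext h2)
              (by rw [← hsnd hpq.2, ← hsnd hpq'.2, h3]))
          exact Prod.ext e1 e2
    _ ≤ 2 * b := by
        rw [Finset.card_product, Finset.card_univ, Fintype.card_fin]
        exact Nat.mul_le_mul_right _ Finset.card_le_two

/-- `|Fin a ×ₗ Fin b| = a b`. [folklore] -/
theorem card_rectSites (a b : ℕ) : Fintype.card (Fin a ×ₗ Fin b) = a * b := by
  rw [Fintype.card_lex, Fintype.card_prod, Fintype.card_fin, Fintype.card_fin]

/-- **The major cut of a rectangular torus.** Cutting `ℤ/(a₁+a₂)ℤ × ℤ/bℤ` into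
`ℤ/a₁ℤ × ℤ/bℤ` and `ℤ/a₂ℤ × ℤ/bℤ` costs at most `8|t| b`:
`E_{(a₁+a₂)×b}(N₁ + N₂) ≤ E_{a₁×b}(N₁) + E_{a₂×b}(N₂) + 8|t| b` for `N_i ≤ 2 a_i b` (product trial
state; the adjacency patterns differ only on the `≤ 2b + 2b` ordered wrap-around pairs).
(Ruelle, *Statistical Mechanics* (1969), §2.) [folklore] -/
theorem groundEnergyAt_rect_cut (a₁ a₂ b : ℕ) (t U : ℝ) {N₁ N₂ : ℕ} (hN₁ : N₁ ≤ 2 * (a₁ * b))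
    (hN₂ : N₂ ≤ 2 * (a₂ * b)) :
    groundEnergyAt (fermionRectTorusGraph (a₁ + a₂) b) t U (N₁ + N₂) ≤
      groundEnergyAt (fermionRectTorusGraph a₁ b) t U N₁ +
        groundEnergyAt (fermionRectTorusGraph a₂ b) t U N₂ + 8 * |t| * b := by
  have h := groundEnergyAt_le_add_of_cut (fermionRectTorusGraph a₁ b) (fermionRectTorusGraph a₂ b)
    (fermionRectTorusGraph (a₁ + a₂) b) (strictMono_rectCastAdd a₁ a₂ b)
    (strictMono_rectNatAdd a₁ a₂ b) (rectCastAdd_lt_rectNatAdd a₁ a₂ b) (rectCastAdd_cover a₁ a₂ b)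
    (card_discrepancy_rectCastAdd a₁ a₂ b) (card_discrepancy_rectNatAdd a₁ a₂ b) t U
    (N₁ := N₁) (N₂ := N₂) (by rwa [card_rectSites]) (by rwa [card_rectSites])
  have : (2 : ℝ) * |t| * ((2 * b : ℕ) + (2 * b : ℕ)) = 8 * |t| * b := by push_cast; ring
  linarith

end RectCut

end Literature.MathematicalPhysics.QuantumLattice
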